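import Summits.Ventures.HodgeRepro2.T5SU11GroundStateTransform

/-!
# The Hardy inequality for compactly supported `C¹` functions: `∫ sinh 2t u² ≤ ∫ sinh 2t (u′)²`

Row 477's ground-state inequality on `[ε, R]`, `∫_ε^R sinh 2t u² ≤ ∫_ε^R sinh 2t (u′)² − (H(u)(R) − H(u)(ε))`,
has vanishing boundary terms when `u` vanishes at `ε` and `R`. Hence for every `C¹` function `u` on `(0, ∞)` with
`u` and `u′` vanishing outside `[a, b] ⊂ (0, ∞)`:

  **`∫_0^∞ sinh 2t u(t)² dt ≤ ∫_0^∞ sinh 2t u′(t)² dt`**  (`hardy_inequality_of_support`),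

i.e. the Dirichlet form `∫ (u′)² sinh 2t` of the radial Laplacian `L = ∂² + 2 coth 2t ∂` dominates `ρ² ∫ u² sinh 2t`
with `ρ = 1` on compactly supported functions — the bottom of the spectrum of `−L` on `L²((0, ∞), sinh 2t dt)` is at
least `ρ² = 1` (it is exactly `1`: the ground state `Ξ = φ_1` realises `Ξ′′ + 2 coth 2t Ξ′ = −Ξ`). Nothing is
claimed about (N).

Blind lane: Mathlib + the HodgeRepro2 prefix only; no sorry; axioms ⊆ {propext, Classical.choice,
Quot.sound}.
-/

namespace Summit.Ventures.HodgeRepro2.T5SU11HardyCompactSupport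

open MeasureTheory intervalIntegral
open Set (Ioi Ioc Icc)
open T5SU11Cartan T5SU11SphericalFunction T5SU11GroundStateTransform

/-- For `g` vanishing outside `[a, b] ⊂ (0, ∞)`: `∫_0^∞ sinh 2t g² = ∫_a^b sinh 2t g²`. -/
theorem integral_Ioi_sinh_mul_sq_eq_of_support {g : ℝ → ℝ} {a b : ℝ} (ha : 0 < a) (hab : a ≤ b)
    (hga : ∀ t, t ≤ a → g t = 0) (hgb : ∀ t, b ≤ t → g t = 0) :
    ∫ t in Ioi 0, Real.sinh (2 * t) * g t ^ 2 = ∫ t in a..b, Real.sinh (2 * t) * g t ^ 2 := by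
  rw [integral_of_le hab]
  refine setIntegral_eq_of_subset_of_forall_sdiff_eq_zero measurableSet_Ioi
    (fun t ht => lt_of_lt_of_le ha ht.1.le) ?_
  intro t ht
  rcases le_or_gt t a with h | h
  · simp only [hga t h, zero_pow (by norm_num : (2 : ℕ) ≠ 0), mul_zero]
  · have hbt : b < t := by
      by_contra hc
      exact ht.2 ⟨h, not_lt.mp hc⟩
    simp only [hgb t hbt.le, zero_pow (by norm_num : (2 : ℕ) ≠ 0), mul_zero]

section measure

variable [MeasurableSpace Circle] [BorelSpace Circle]

omit [BorelSpace Circle] in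
/-- The ground-state bracket vanishes where `u` does. -/
theorem hardyBracket_eq_zero {u : ℝ → ℝ} {t : ℝ} (hu : u t = 0) : hardyBracket u t = 0 := by
  unfold hardyBracket
  rw [hu]
  ring

/-- **The Hardy inequality for compactly supported `C¹` functions**: if `u` is `C¹` on `(0, ∞)` with `u` and `u′`
vanishing outside `[a, b] ⊂ (0, ∞)`, then `∫_0^∞ sinh 2t u² ≤ ∫_0^∞ sinh 2t (u′)²`. -/
theorem hardy_inequality_of_support {u u' : ℝ → ℝ} (hu : ∀ t, 0 < t → HasDerivAt u (u' t) t)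
    (hcu' : ContinuousOn u' (Ioi 0)) {a b : ℝ} (ha : 0 < a) (hab : a ≤ b)
    (hua : ∀ t, t ≤ a → u t = 0) (hub : ∀ t, b ≤ t → u t = 0)
    (hu'a : ∀ t, t ≤ a → u' t = 0) (hu'b : ∀ t, b ≤ t → u' t = 0) :
    ∫ t in Ioi 0, Real.sinh (2 * t) * u t ^ 2 ≤ ∫ t in Ioi 0, Real.sinh (2 * t) * u' t ^ 2 := by
  rw [integral_Ioi_sinh_mul_sq_eq_of_support ha hab hua hub,
    integral_Ioi_sinh_mul_sq_eq_of_support ha hab hu'a hu'b]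
  have h := hardy_ineq_interval hu hcu' ha hab
  rw [hardyBracket_eq_zero (hub b le_rfl), hardyBracket_eq_zero (hua a le_rfl)] at h
  linarith

end measure

end Summit.Ventures.HodgeRepro2.T5SU11HardyCompactSupport
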